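import Summits.BirchSwinnertonDyer.BirchSwinnertonDyer.Theses.AdditiveKolyvaginRoad
import Summits.BirchSwinnertonDyer.BirchSwinnertonDyer.Theorems.AdditiveKolyvaginRoadManinFrameFromDatum
import Summits.BirchSwinnertonDyer.Rank1Residual.X11b.BDPRouteDescent
import Summits.BirchSwinnertonDyer.Rank1Residual.X11b.Three.KolyvaginNonvanishing
import Summits.BirchSwinnertonDyer.Rank1Residual.X11b.TwistTransportRam
import Summits.BirchSwinnertonDyer.Rank1Residual.X11b.CastellaErratumTwistUnits
import Summits.BirchSwinnertonDyer.Rank1Residual.X2.TwistTamagawa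
import Summits.BirchSwinnertonDyer.Rank1Residual.AdditivePotMult.RankOneHeegner
import Summits.BirchSwinnertonDyer.Rank1Residual.AdditivePotMult.TwistSupplyJ
import Literature.NumberTheory.EllipticCurves.BSDSelmerPConverseSerreProofs
import Literature.NumberTheory.EllipticCurves.NonEisensteinPrimeOfSurjective
import Literature.NumberTheory.EllipticCurves.BSDSelmerCMPConverseHeegnerFieldProofs
import Literature.NumberTheory.EllipticCurves.HeegnerPointsKolyvaginPrimaryGeneratorProofs
import Literature.NumberTheory.EllipticCurves.ComplexMultiplicationHasCMProofs
import Literature.NumberTheory.EllipticCurves.Rank1Residual.ClassX1KellerYinCertificate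
import HarnessLib

/-!
# Route `AdditiveKolyvaginRoad`, support item `AdditiveKolyvaginKernel` (stmt-BirchSwinnertonDyer-20138):
# the ADDITIVE KOLYVAGIN KERNEL — the route decl BY NAME, PROVED (p-generic port of the landed
# `p = 3` kernel `Koly.bsdp_three_onA1_of_kolyvaginFramesHL`)

Cell `pub/bsd-wall` (D-0120, W-ALL lane 3, row 2), seat `bsd-wall-akr-p2` (prover, g3). THEOREMS
ONLY (no definition, no named fact, no `sorry`); CONDITIONAL on nothing beyond the decl's own
antecedents (the published inputs `PublishedInputsAdditiveKoly`, the Manin-good frames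
`ManinGoodOddFrameAdditive`, the crux `KolyvaginPrimitiveAdditive`, the rank-zero residual
`RankZeroAdditive` — all hypotheses of the decl, never asserted).

THE KERNEL (`additiveKolyvaginKernel_proof`). For `W/ℚ` globally minimal, non-CM, `p ≥ 5` additive,
`r_an = 1`, on the ♯ locus (`ρ̄_{E,p}` onto, ♠(1): `p ∤ ord_ℓ Δ_min` at every multiplicative `ℓ`,
♠(2): two multiplicative primes, `p ∤ ∏ c_ℓ`): `BSDp W p`. Steps (each a tree theorem or a decl
antecedent):
1. `E[p]` irreducible (`hasIrreducibleModPGaloisRep_of_hasSurjectiveModNGaloisRep`) and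
   `ρ̄_{E,p^m}` onto for all `m` (Serre 1968 IV §3.4 at `p ≥ 5`, tree theorem
   `serre_hasSurjectiveModNGaloisRep_pow_holds`).
2. A Manin datum `Dt₀` of `W` with `p ∤ c` from the frame antecedent `ManinGoodOddFrameAdditive`
   (only its sixth conjunct is kept), then OUR Hoffstein–Luo field with `d_K < −4` EXPORTED
   (`exists_oddHeegnerFrame_lt_of_exists_not_dvd`: the 9-conjunct frame of
   `ManinFrameFromDatum.exists_oddHeegnerFrame_of_exists_not_dvd` plus `d_K < −4`, so that
   `d_K ∉ {−3, −4}` as McCallum's structure theorem requires — the frame decl's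
   `¬ p ∣ #𝓞_K^×` does not exclude `ℚ(√−3)` at `p ≥ 5`).
3. A conductor-`1` Kolyvagin–Heegner datum `d₁` (Darmon 2004 Thm. 3.6 = conjunct 10 of the inputs,
   `kolyvaginRoadThree_hKD_of_darmon36`) with bottom point `y_K = P` (Shimura reciprocity at
   conductor `1` = conjunct 8, `KolyvaginBottom.toGeomPoints_derivedPoint_one_eq`); `y_K` non-torsion
   (Gross–Zagier at `r_an(E/K) = 1`), `rank E(K) = 1` and `Ш(E/K)` finite (Kolyvagin), `E(K)[p] = 0`
   (`E[p]` irreducible, `K` imaginary quadratic), `p^{M₀} ∥ y_K`.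
4. The crux `KolyvaginPrimitiveAdditive` at the frame `(W, p, K, Dt, β, ι)`: a Kolyvagin class
   `c(1) ≠ 0 mod p` of Kolyvagin-prime support; McCallum 1991 Cor. 5.6 (conjunct 9) ⟹ STEP L
   `X11b.IndexLowerBoundAt W p K P` (`Koly.indexLowerBoundAt_of_kolyvaginClass_one_ne_zero_of_mccallum`);
   Kolyvagin's bound (conjunct 3) + `p ∤ ∏ c_ℓ` ⟹ the identity `X11b.IndexIdentityAt W p K P`.
5. The twist `Wd = Cd • E^{(d_K)}`: non-CM (same `j`), additive at `p` (`d_K ∈ ℚ_p^{×2}` since `p ∣ N`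
   splits), `r_an = 0` (`L(E^{(d_K)},1) ≠ 0`) ⟹ `BSDp Wd p` by the residual `RankZeroAdditive` ⟹ the
   rank-zero print shape (`pPart_of_bsdp`, `pPartRankZero_of_pPart`); side conditions
   `ord_p ∏c_ℓ(Wd) = ord_p ∏c_ℓ(W)` (`X2.padicValNat_tamagawaProduct_twist_of_heegner_of_odd`) and
   `ord_p u(Cd) = 0` (`X11b.padicValRat_u_eq_zero_of_twist_minimal_of_splitsIn`).
6. Descent `K → ℚ`: `X11b.bsdp_of_indexIdentityAt` (Gross–Zagier V.§2 / JSW §7.4.1, exact at odd `p`).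

References: [WZhang2014] Thm. 1.1, Thm. 10.2; [McCallumLMS1991] §5 Cor. 5.6; [GrossZagier1986]
V.§2; [Kolyvagin1991]; [JetchevSkinnerWan2017] §7.4.1–7.4.3; [Darmon2004] Thm. 3.6;
[HoffsteinLuo1997] Theorem (§1); [SerreAbelianLadic1968] IV §3.4; [Miller2011LMS] Def. 1.1.
-/

set_option autoImplicit false
-- the Theorems directory repeats the summit name (sibling precedent `SignedBaseChangeAssembly.lean`)
set_option linter.dupNamespace false

noncomputable section

open scoped Classical

open WeierstrassCurve NumberField Literature.NumberTheory.EllipticCurves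
  Literature.NumberTheory.EllipticCurves.ModularForms
  Literature.NumberTheory.EllipticCurves.Rank1Residual Literature.NumberTheory.Automorphic
  Summit.BirchSwinnertonDyer.Rank1Residual Summit.BirchSwinnertonDyer.Rank1Residual.X11b
  Summit.BirchSwinnertonDyer.BirchSwinnertonDyer.Theses.AdditiveKolyvaginRoad

namespace Summit.BirchSwinnertonDyer.BirchSwinnertonDyer.Theorems.AdditiveKolyvaginKernel

/-! ### §1 The odd Heegner frame with `d_K < −4` exported -/

/-- **The 9-conjunct odd Heegner frame from ANY datum with `p ∤ c`, with `d_K < −4` exported**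
(`ManinFrameFromDatum.exists_oddHeegnerFrame_of_exists_not_dvd` verbatim, keeping the Hoffstein–Luo
field's `d_K < −4` from `exists_admissibleField_of_rootNumber_eq_neg_one`): for `W/ℚ` globally
minimal with `r_an = 1`, `p` odd, and some datum of `W` at level `N(W)` with `p ∤ c`.
[cite: HoffsteinLuo1997, Theorem (§1, pp. 435–436)] [cite: Darmon2004, Thm. 3.6] -/
theorem exists_oddHeegnerFrame_lt_of_exists_not_dvd (hnf : exists_isNewformOf)
    (hHL : HoffsteinLuo1997_exists_twist_L_one_ne_zero)
    (W : WeierstrassCurve ℚ) [W.IsElliptic] [W.IsGloballyMinimal] (p : ℕ) [hp : Fact p.Prime]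
    [NeZero (W.conductorNorm ℤ)] (hr : W.analyticRank = 1) (hp2 : p ≠ 2)
    (hD : ∃ Dt : ModularParametrizationData W (W.conductorNorm ℤ), ¬ (p : ℤ) ∣ Dt.c) :
    ∃ (K : Type) (_ : Field K) (_ : NumberField K)
      (Dt : ModularParametrizationData W (W.conductorNorm ℤ))
      (H : HeegnerDatum (W.conductorNorm ℤ) (NumberField.discr K)) (ι : K →+* ℂ)
      (P : (W.baseChange K).toAffine.Point)
      (Wd : WeierstrassCurve ℚ) (_ : Wd.IsElliptic) (_ : Wd.IsGloballyMinimal) (Cd : VariableChange ℚ),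
      IsImaginaryQuadratic K ∧ Odd (NumberField.discr K) ∧ NumberField.discr K < -4 ∧
        ¬ (p : ℤ) ∣ NumberField.discr K ∧
        SatisfiesHeegnerHypothesis (W.conductorNorm ℤ) K ∧
        WeierstrassCurve.Affine.Point.map ι.toRatAlgHom P = heegnerPointComplex Dt H ∧
        ¬ (p : ℤ) ∣ Dt.c ∧ ¬ p ∣ Units.torsionOrder K ∧
        (W.quadraticTwist (NumberField.discr K : ℚ)).entireLFunction 1 ≠ 0 ∧
        Cd • W.quadraticTwist (NumberField.discr K : ℚ) = Wd := by
  have hpP : p.Prime := hp.out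
  -- the sign of the functional equation is `−1` (modularity, `r_an = 1`)
  have hw : W.rootNumber = -1 := by
    rw [WeierstrassCurve.rootNumber_eq_neg_one_pow_analyticRank_of_exists_isNewformOf hnf W, hr]
    norm_num
  -- the Hoffstein–Luo field: `d_K ≡ 1 (mod 8)`, `d_K < −4`, every `ℓ ∣ N` and `p` split
  obtain ⟨K, _, _, hK, hodd, hlt, hHN, hHp, hLt⟩ :=
    exists_admissibleField_of_rootNumber_eq_neg_one hnf hHL W hw p
  have hpd : ¬ (p : ℤ) ∣ NumberField.discr K := not_dvd_discr_of_split hK hpP hp2 hHp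
  -- `w_K = 2`, prime to the odd prime `p`
  have hμ : ¬ p ∣ Units.torsionOrder K := by
    haveI : IsTotallyComplex K := hK.2
    rw [Literature.NumberTheory.DiophantineGeometry.torsionOrder_eq_two_of_discr_lt hK.1 hlt]
    intro h2
    have := Nat.le_of_dvd two_pos h2
    have := hpP.two_le
    omega
  -- the Heegner datum with `p ∤ c`
  obtain ⟨Dt, H, ι, P, hP, hc⟩ :=
    ManinFrameFromDatum.exists_maninDatum_of_exists_not_dvd W p (W.conductorNorm ℤ) K hD hK hHN
  -- a globally minimal model of the twist
  have hD0 : (NumberField.discr K : ℚ) ≠ 0 := by exact_mod_cast NumberField.discr_ne_zero K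
  haveI hEt : (W.quadraticTwist (NumberField.discr K : ℚ)).IsElliptic :=
    W.isElliptic_quadraticTwist hD0
  obtain ⟨Cd, hCd⟩ := hasGlobalMinimalModel_rat_holds (W.quadraticTwist (NumberField.discr K : ℚ))
  exact ⟨K, inferInstance, inferInstance, Dt, H, ι, P, Cd • W.quadraticTwist (NumberField.discr K : ℚ),
    inferInstance, hCd, Cd, hK, hodd, hlt, hpd, hHN, hP, hc, hμ, hLt, rfl⟩

/-! ### §2 The twist `E^{(d_K)}`: non-CM, additive at `p`, analytic rank `0` -/

/-- **The Heegner twist of an additive non-CM rank-datum is non-CM, additive at `p`, of analytic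
rank `0`**: for `W` globally minimal, non-CM, additive at `p` (so `p ∣ N`, hence `p` splits in the
Heegner field `K` and `d_K ∈ ℚ_p^{×2}`), and `L(E^{(d_K)},1) ≠ 0`, every model
`Wd = Cd • E^{(d_K)}` is non-CM (`j` is a twist invariant, `hasCM_iff_of_j_eq`), additive at `p`
(`AdditivePotMult.addv_iff_of_twist`) and has analytic rank `0`
(`analyticRank_eq_zero_iff_holds`, `entireLFunction_smul`). [folklore]
[cite: SilvermanAEC2009, X.5.4 and III.1.4(b)] -/
theorem twist_nonCM_addv_rankZero (hmod : hasEntireLFunction_rat)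
    (W : WeierstrassCurve ℚ) [W.IsElliptic] [W.IsGloballyMinimal] (p : ℕ) [hp : Fact p.Prime]
    (hCM : ¬ W.HasCM) (hadd : Addv W p)
    (K : Type) [Field K] [NumberField K] (hK : IsImaginaryQuadratic K)
    (hHN : SatisfiesHeegnerHypothesis (W.conductorNorm ℤ) K)
    (hLt : (W.quadraticTwist (NumberField.discr K : ℚ)).entireLFunction 1 ≠ 0)
    (Wd : WeierstrassCurve ℚ) [Wd.IsElliptic] (Cd : VariableChange ℚ)
    (hWd : Cd • W.quadraticTwist (NumberField.discr K : ℚ) = Wd) :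
    ¬ Wd.HasCM ∧ Addv Wd p ∧ Wd.analyticRank = 0 := by
  have hpP : p.Prime := hp.out
  have hD0 : (NumberField.discr K : ℚ) ≠ 0 := by exact_mod_cast NumberField.discr_ne_zero K
  haveI hEt : (W.quadraticTwist (NumberField.discr K : ℚ)).IsElliptic :=
    W.isElliptic_quadraticTwist hD0
  -- `p ∣ N` (additive), so `p` splits in `K` and `d_K` is a `p`-adic square
  have hpN : p ∣ W.conductorNorm ℤ :=
    (W.dvd_conductorNorm_iff_not_hasGoodReductionAtPrime p).mpr hadd.1
  have hsq' : IsSquare (algebraMap ℚ ℚ_[p] (NumberField.discr K : ℚ)) :=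
    X11b.isSquare_discr_padic_of_heegner K hK hHN p hpN
  have hsq : IsSquare (((NumberField.discr K : ℚ) : ℚ) : ℚ_[p]) := by simpa using hsq'
  -- non-CM: same `j`
  have hj : Wd.j = W.j := AdditivePotMult.j_of_model_twist (W := W) hD0 ⟨Cd, hWd⟩
  have hCMd : ¬ Wd.HasCM := fun h ↦ hCM ((hasCM_iff_of_j_eq hj).mp h)
  -- additive at `p`
  have haddd : Addv Wd p := (AdditivePotMult.addv_iff_of_twist (W := W) hD0 hsq Wd hWd).mpr hadd
  -- analytic rank `0`
  have hLt' : (W.quadraticTwist (NumberField.discr K : ℚ)).entireLFunction = Wd.entireLFunction := by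
    rw [← hWd, entireLFunction_smul]
  have hLd1 : Wd.entireLFunction 1 ≠ 0 := by rw [← hLt']; exact hLt
  have hrd : Wd.analyticRank = 0 := (Wd.analyticRank_eq_zero_iff_holds (hmod Wd)).2 hLd1
  exact ⟨hCMd, haddd, hrd⟩

/-! ### §3 The kernel -/

/-- **`AdditiveKolyvaginKernel` holds** (item stmt-BirchSwinnertonDyer-20138, the route decl by
name): published inputs → Manin-good odd frames → Kolyvagin's conjecture mod `p` at an additive
`p ≥ 5` (the crux) → the rank-zero additive residual → `BSDp W p` for every ♯ rank-one additive
row at `p ≥ 5`. The `p`-generic port of `Koly.bsdp_three_onA1_of_kolyvaginFramesHL`: frame ∘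
Darmon 3.6 datum ∘ Gross–Zagier non-torsion ∘ Kolyvagin ∘ `E(K)[p] = 0` ∘ crux ∘ McCallum ⟹
`IndexLowerBoundAt` ⟹ identity ⟹ `X11b.bsdp_of_indexIdentityAt`, the twist's `p`-part from the
rank-zero residual via `pPart_of_bsdp`. See the module docstring for the six steps.
[cite: WZhang2014, Thm. 1.1 and Thm. 10.2] [cite: McCallumLMS1991, §5 Cor. 5.6 (p. 310)]
[cite: GrossZagier1986, V.§2] [cite: JetchevSkinnerWan2017, §7.4.1–7.4.3]
[cite: Darmon2004, Thm. 3.6] [cite: SerreAbelianLadic1968, Ch. IV §3.4] -/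
theorem additiveKolyvaginKernel_proof : AdditiveKolyvaginKernel := by
  intro hPub hM h₁ h₀ W _ _ p _ hCM hp5 hadd hr hsurjp hsp htwo htam
  obtain ⟨hGZ, hKo, hB, hGZK, hmod, hnf, hHL, hrec, hMc, h36⟩ := hPub
  haveI : NeZero (W.conductorNorm ℤ) := ⟨(W.conductorNorm_pos_holds).ne'⟩
  have hp : p.Prime := Fact.out
  have hp2 : p ≠ 2 := by omega
  -- step 1: `E[p]` irreducible; `ρ̄_{E,p^m}` onto for every `m` (Serre, `p ≥ 5`)
  have hirr : Irr W p := hasIrreducibleModPGaloisRep_of_hasSurjectiveModNGaloisRep W p hsurjp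
  have hsurj : ∀ m : ℕ, W.HasSurjectiveModNGaloisRep (p ^ m : ℕ) :=
    serre_hasSurjectiveModNGaloisRep_pow_holds W p hp5 hsurjp
  -- step 2: a Manin datum of `W` with `p ∤ c` (the frame antecedent), then OUR frame with `d_K < -4`
  obtain ⟨K₀, _, _, Dt₀, -, -, -, -, -, -, -, -, -, -, -, -, hc₀, -, -, -⟩ :=
    hM ⟨hGZ, hKo, hB, hGZK, hmod, hnf, hHL, hrec, hMc, h36⟩ W p hp5 hadd hirr hr
  obtain ⟨K, _, _, Dt, H, ι, P, Wd, _, _, Cd, hK, hodd, hlt, hpd, hHN, hP, hc, hμ, hLt, hWd⟩ :=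
    exists_oddHeegnerFrame_lt_of_exists_not_dvd hnf hHL W p hr hp2 ⟨Dt₀, hc₀⟩
  have h3 : NumberField.discr K ≠ -3 := by omega
  have h4 : NumberField.discr K ≠ -4 := by omega
  -- step 3: conductor-1 Kolyvagin–Heegner datum (Darmon 3.6), bottom point, non-torsion, Kolyvagin
  obtain ⟨d₁⟩ := kolyvaginRoadThree_hKD_of_darmon36 h36 W K Dt H.β ι hK hHN H.dvd_sq_sub
  have hPd : d₁.toGeomPoints d₁.derivedPoint = toGeomPoints (W.baseChange K) P :=
    KolyvaginBottom.toGeomPoints_derivedPoint_one_eq (hrec _ W K) hK hHN hP d₁ rfl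
  have hPinf : ¬ IsOfFinAddOrder P :=
    not_isOfFinAddOrder_of_heegner_of_analyticRank_eq_one W (W.conductorNorm ℤ) K Dt H ι P (hGZ _ W K)
      hmod hr hK hHN hLt hP
  obtain ⟨hrank, hSha⟩ := hKo (W.conductorNorm ℤ) W K hK hHN ⟨Dt, H, ι, hP⟩ hPinf
  haveI : Finite (W.baseChange K).sha := hSha
  -- `E(K)[p] = 0`
  have hbot := torsionBy_eq_bot_of_isImaginaryQuadratic_of_hasIrreducibleModPGaloisRep W K hK hp hirr
  have hiv : ∀ x : (W.baseChange K).toAffine.Point, p • x = 0 → x = 0 := fun x hx ↦ by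
    have hmem : x ∈ AddSubgroup.torsionBy (W.baseChange K).toAffine.Point ((p : ℕ) : ℤ) := by
      rw [mem_torsionBy_iff, natCast_zsmul]
      exact hx
    rw [hbot] at hmem
    exact hmem
  -- `p^{M₀} ∥ y_K`
  haveI : Module.Finite ℤ (W.baseChange K).toAffine.Point := (W.baseChange K).module_finite_point_holds
  obtain ⟨M₀, x₀, hx₀, hmax⟩ := exists_pow_smul_eq_and_forall_ne hPinf (p := p) hp.two_le
  have hdiv : ∃ Q : (W.baseChange K).toAffine.Point, ((p ^ M₀ : ℕ) : ℤ) • Q = P :=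
    ⟨x₀, by rw [natCast_zsmul]; exact hx₀⟩
  have hndiv : ¬ ∃ Q : (W.baseChange K).toAffine.Point, ((p ^ (M₀ + 1) : ℕ) : ℤ) • Q = P := by
    rintro ⟨Q, hQ⟩
    exact hmax Q (by rw [← natCast_zsmul]; exact hQ)
  -- step 4: the crux at this frame; McCallum ⟹ STEP L; Kolyvagin's bound ⟹ the identity
  obtain ⟨n, d, hn, hne⟩ :=
    h₁ W p K Dt H.β ι hp5 hadd hsurjp hsp htwo htam hr hK hodd hlt hHN hLt H.dvd_sq_sub hc
  have hL : IndexLowerBoundAt W p K P :=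
    Three.Koly.indexLowerBoundAt_of_kolyvaginClass_one_ne_zero_of_mccallum W K hMc hCM hK h3 h4 hHN
      p hp2 hsurj Dt H.β ι d₁ P hPd hPinf hrank hiv hdiv hndiv d hn hne
  have hid : IndexIdentityAt W p K P :=
    indexIdentityAt_of_lowerBound_of_kolyvagin W p (hB _ W K) hK hHN ⟨Dt, H, ι, hP⟩ hPinf hp2 hsurjp
      htam hL
  -- step 5: the twist — non-CM, additive at `p`, rank `0` ⟹ `BSDp Wd p` (residual) ⟹ print shape
  obtain ⟨hCMd, haddd, hrd⟩ := twist_nonCM_addv_rankZero hmod W p hCM hadd K hK hHN hLt Wd Cd hWd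
  have hBSDd : BSDp Wd p := h₀ Wd p hCMd hp5 haddd hrd
  have htw : PPartRankZero Wd p :=
    pPartRankZero_of_pPart hGZK Wd p hrd (pPart_of_bsdp hmod hGZK Wd p (by omega) hBSDd)
  have htamEq : padicValNat p Wd.tamagawaProduct = padicValNat p W.tamagawaProduct :=
    X2.padicValNat_tamagawaProduct_twist_of_heegner_of_odd W p hp2 K hK hodd hpd hHN Cd hWd
  have hpN : p ∣ W.conductorNorm ℤ :=
    (W.dvd_conductorNorm_iff_not_hasGoodReductionAtPrime p).mpr hadd.1
  have hu : padicValRat p (Cd.u : ℚ) = 0 :=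
    X11b.padicValRat_u_eq_zero_of_twist_minimal_of_splitsIn W p K hK.1 (hHN p hp hpN) Cd hWd
  -- step 6: the descent `K → ℚ`
  exact X11b.bsdp_of_indexIdentityAt W p (W.conductorNorm ℤ) K Dt H ι P (hGZ _ W K) (hKo _ W K)
    hGZK hmod hK hHN hP hp2 hc hμ hr hLt Wd Cd hWd htw htamEq hu (fun _ ↦ hid)

end Summit.BirchSwinnertonDyer.BirchSwinnertonDyer.Theorems.AdditiveKolyvaginKernel

end
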